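import Summits.QuantumFields.BalabanUV.Beta.EriceFlowEnclosureGevreySectorDeriv
import Summits.QuantumFields.BalabanUV.Beta.EriceFlowEnclosureGevreyCalc
import Mathlib.Analysis.Calculus.MeanValue

/-!
# Beta / EriceFlowEnclosureGevreySectorAlgebra — SERVICE: sectorial Gevrey-1 expansions (‖f z − Σ_{k<N} a_k z^k‖ ≤ C·K^N·N!·‖z‖^N
# for EVERY N) are an algebra closed under primitives — LETTERS of such an expansion are Gevrey-1 (`letters_gevrey`), PRODUCTS keep the
# class with explicit constants (`truncProd_eq`, `gevrey_mul`, pointwise), and so do PRIMITIVES along the rays of a sector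
# (`gevrey_primitive`, mean-value inequality on segments) — uniformly in the order N.

WHAT.  MODULE 32 (bflow-p3 gen 35) typed the sectorial Gevrey-1 asymptotics of the Markov scale coordinate Λ̃ (32g ∕ 32h), of its
derivative (32j) and of the modified generator β̃ = −b₀∕(z²Λ̃′) (32k) on sectors of opening > π, with Watson uniqueness (32a).  The last
object of the lineage's dictionary, the exponent `E = log(β̃∕b₀)` (MODULES 25 ∕ 30 ∕ 31: `β̃ = b₀·exp E`, `−s²Λ_M′ = exp(−E)`), is the
LOGARITHM of a sectorial Gevrey-1 function; `log f` is the primitive of `f′·f⁻¹` — 32i differentiates, 32k-a inverts, and this file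
supplies the two missing closure rules:
  * `letters_gevrey` — the letters of a Gevrey-1 expansion at ONE point z ≠ 0 are Gevrey-1: |a_k| ≤ C(1 + K‖z‖)·(2K)^k·k!
    (a_k z^k is the difference of two consecutive remainders) [Loday-Richaud, Prop. 1.2.10];
  * `truncProd_eq` ∕ `gevrey_mul` — the order-N truncation of a product is `Σ_{i<N} a_i z^i · g_{N−i}(z)` (g_M the order-M partial sum
    of the second factor), whence `f·g − T_N = (f − f_N)·g + Σ_{i<N} a_i z^i (g − g_{N−i})` and the bound
    `(C_a C_b + 3 L_a C_b)·max(K_a, K_b, E_a)^N·N!·‖z‖^N` by `Σ_{i≤N} i!(N−i)! ≤ 3·N!` (28a) [Loday-Richaud, Prop. 1.2.12];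
  * `gevrey_primitive` — on a sector S(r, σ) = {‖z‖ < r, Re z > −σ‖z‖} (star-shaped along its rays t·z, 0 < t ≤ 1): if G′ = g on S,
    G(tz) → 0 as t → 0⁺, and g has the expansion with letters d, then ‖G z − Σ_{k<N} (d_k∕(k+1)) z^{k+1}‖ ≤ C·K^N·N!·‖z‖^{N+1} for every
    N (mean-value inequality `norm_image_sub_le_of_norm_deriv_le_segment'` on [ε, 1], then ε → 0⁺).
PRESEARCH.  [corpus: book:loday-richaud2016 Prop. 1.2.10 p. 17, Prop. 1.2.12 p. 18 («𝒜̄_s(Δ) is a differential ℂ-algebra», proved there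
via the derivative characterisation Prop. 1.2.11); here by truncation algebra, constants explicit and uniform in N]; Mathlib: no sectorial
Gevrey class (`lean search "Gevrey"` = 28–32 of this lineage only).
HONEST.  [folklore] elementary analysis (Mathlib: mean-value inequality, `HasDerivAt` calculus, finite sums); no β-function, no
`Conclusions S`; NOT B12 Thm 2, NOT BetaPertH, NOT continuum, NOT Clay.
HONEST DEPENDENCY: continuum YM on T⁴ ⇐ BetaPertH ∧ nine spine estimates (0/9 proved); BetaPertH ⇐ (D1) ∧ (D4) ∧ CAP+tail;
G-an2-4 gates asym, D1 and NE2/3/4.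
-/

noncomputable section

open Set Filter Topology

open scoped Nat

namespace Summit.QuantumFields.BalabanUV.Beta.EriceFlowEnclosureGevreySectorAlgebra

open Summit.QuantumFields.BalabanUV.Beta.EriceFlowEnclosureGevreyCalc (sum_factorial_mul_factorial_le)

/-! ## §1 Letters of a Gevrey-1 expansion are Gevrey-1 -/

/-- **LETTERS ARE GEVREY-1.**  If at ONE point z ≠ 0 `‖f − Σ_{k<N} a_k z^k‖ ≤ C·K^N·N!·‖z‖^N` for every N (C ≥ 0, K > 0), then
`|a_k| ≤ C(1 + K‖z‖)·(2K)^k·k!` for every k: `a_k z^k` is the difference of the remainders of orders k and k+1, and `k + 1 ≤ 2^k`.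
[folklore; Loday-Richaud 2016, Prop. 1.2.10] -/
theorem letters_gevrey {a : ℕ → ℝ} {C K : ℝ} {f z : ℂ} (hC : 0 ≤ C) (hK : 0 < K) (hz : z ≠ 0)
    (hf : ∀ N : ℕ, ‖f - ∑ k ∈ Finset.range N, ((a k : ℝ) : ℂ) * z ^ k‖ ≤ C * K ^ N * N ! * ‖z‖ ^ N) :
    ∀ k, |a k| ≤ C * (1 + K * ‖z‖) * ((2 * K) ^ k * k !) := by
  intro k
  have hnz : 0 < ‖z‖ := norm_pos_iff.mpr hz
  have e : ((a k : ℝ) : ℂ) * z ^ k = (f - ∑ i ∈ Finset.range k, ((a i : ℝ) : ℂ) * z ^ i)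
      - (f - ∑ i ∈ Finset.range (k + 1), ((a i : ℝ) : ℂ) * z ^ i) := by
    rw [Finset.sum_range_succ]; ring
  have hn : ‖((a k : ℝ) : ℂ) * z ^ k‖ = |a k| * ‖z‖ ^ k := by
    rw [norm_mul, norm_pow, Complex.norm_real, Real.norm_eq_abs]
  have h3 : |a k| * ‖z‖ ^ k ≤ C * K ^ k * k ! * ‖z‖ ^ k + C * K ^ (k + 1) * (k + 1)! * ‖z‖ ^ (k + 1) := by
    rw [← hn, e]
    exact (norm_sub_le _ _).trans (add_le_add (hf k) (hf (k + 1)))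
  have hk1 : (k : ℝ) + 1 ≤ 2 ^ k := by exact_mod_cast Nat.succ_le_of_lt Nat.lt_two_pow_self
  have hKz : 0 ≤ K * ‖z‖ := by positivity
  have h4 : |a k| * ‖z‖ ^ k ≤ C * (1 + K * ‖z‖) * ((2 * K) ^ k * k !) * ‖z‖ ^ k := by
    calc |a k| * ‖z‖ ^ k ≤ C * K ^ k * k ! * ‖z‖ ^ k + C * K ^ (k + 1) * (k + 1)! * ‖z‖ ^ (k + 1) := h3
      _ = C * K ^ k * k ! * ‖z‖ ^ k * (1 + K * ‖z‖ * ((k : ℝ) + 1)) := by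
          rw [Nat.factorial_succ]; push_cast; ring
      _ ≤ C * K ^ k * k ! * ‖z‖ ^ k * ((1 + K * ‖z‖) * 2 ^ k) := by
          apply mul_le_mul_of_nonneg_left _ (by positivity)
          have h5 : (1 + K * ‖z‖) * ((k : ℝ) + 1) ≤ (1 + K * ‖z‖) * 2 ^ k :=
            mul_le_mul_of_nonneg_left hk1 (by positivity)
          have e2 : (1 + K * ‖z‖) * ((k : ℝ) + 1) = 1 + K * ‖z‖ * ((k : ℝ) + 1) + k := by ring
          linarith [(Nat.cast_nonneg k : (0 : ℝ) ≤ k)]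
      _ = C * (1 + K * ‖z‖) * ((2 * K) ^ k * k !) * ‖z‖ ^ k := by rw [mul_pow]; ring
  exact le_of_mul_le_mul_right h4 (pow_pos hnz k)

/-! ## §2 Products -/

/-- **THE TRUNCATED PRODUCT.**  `Σ_{i<N} a_i z^i · (Σ_{k<N−i} b_k z^k) = Σ_{n<N} (Σ_{i≤n} a_i b_{n−i}) z^n` — the order-N truncation of
the product of two series is the first factor's order-N truncation against the second's COMPLEMENTARY truncations (induction on N).
[folklore] -/
theorem truncProd_eq (a b : ℕ → ℝ) (z : ℂ) (N : ℕ) :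
    ∑ i ∈ Finset.range N, ((a i : ℝ) : ℂ) * z ^ i * ∑ k ∈ Finset.range (N - i), ((b k : ℝ) : ℂ) * z ^ k
      = ∑ n ∈ Finset.range N, ((∑ i ∈ Finset.range (n + 1), a i * b (n - i) : ℝ) : ℂ) * z ^ n := by
  induction N with
  | zero => simp
  | succ N ih =>
    rw [Finset.sum_range_succ]
    conv_rhs => rw [Finset.sum_range_succ]
    rw [← ih]
    have e1 : ∀ i ∈ Finset.range N, ((a i : ℝ) : ℂ) * z ^ i * ∑ k ∈ Finset.range (N + 1 - i), ((b k : ℝ) : ℂ) * z ^ k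
        = ((a i : ℝ) : ℂ) * z ^ i * ∑ k ∈ Finset.range (N - i), ((b k : ℝ) : ℂ) * z ^ k
          + ((a i * b (N - i) : ℝ) : ℂ) * z ^ N := by
      intro i hi
      have hi' : i ≤ N := (Finset.mem_range.mp hi).le
      have hz : z ^ N = z ^ i * z ^ (N - i) := by rw [← pow_add, Nat.add_sub_cancel' hi']
      rw [Nat.sub_add_comm hi', Finset.sum_range_succ, mul_add, hz]
      push_cast; ring
    have e2 : ∑ k ∈ Finset.range (N + 1 - N), ((b k : ℝ) : ℂ) * z ^ k = (b 0 : ℝ) := by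
      rw [Nat.add_sub_cancel_left, Finset.sum_range_one, pow_zero, mul_one]
    rw [Finset.sum_congr rfl e1, Finset.sum_add_distrib, e2, Finset.sum_range_succ (fun i => a i * b (N - i)) N,
      Nat.sub_self]
    push_cast
    rw [add_mul, Finset.sum_mul]
    ring

/-- **PRODUCT OF TWO GEVREY-1 EXPANSIONS (pointwise, explicit constants).**  If at a point z `‖f − Σ_{k<N} a_k z^k‖ ≤ C_a·K_a^N·N!·‖z‖^N`
and `‖g − Σ_{k<N} b_k z^k‖ ≤ C_b·K_b^N·N!·‖z‖^N` for EVERY N, and `|a_k| ≤ L_a·E_a^k·k!`, then for every N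
`‖f·g − Σ_{n<N} (Σ_{i≤n} a_i b_{n−i}) z^n‖ ≤ (C_a C_b + 3 L_a C_b)·max(K_a, K_b, E_a)^N·N!·‖z‖^N`:
`f·g − T_N = (f − f_N)·g + Σ_{i<N} a_i z^i (g − g_{N−i})` (`truncProd_eq`), `‖g‖ ≤ C_b` (order 0), and `Σ_{i≤N} i!(N−i)! ≤ 3·N!` (28a).
[folklore; Loday-Richaud 2016, Prop. 1.2.12] -/
theorem gevrey_mul {a b : ℕ → ℝ} {Ca Ka Cb Kb La Ea : ℝ} {f g z : ℂ}
    (hCa : 0 ≤ Ca) (hKa : 0 < Ka) (hCb : 0 ≤ Cb) (hKb : 0 < Kb) (hLa : 0 ≤ La) (hEa : 0 < Ea)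
    (ha : ∀ k, |a k| ≤ La * (Ea ^ k * k !))
    (hf : ∀ N : ℕ, ‖f - ∑ k ∈ Finset.range N, ((a k : ℝ) : ℂ) * z ^ k‖ ≤ Ca * Ka ^ N * N ! * ‖z‖ ^ N)
    (hg : ∀ N : ℕ, ‖g - ∑ k ∈ Finset.range N, ((b k : ℝ) : ℂ) * z ^ k‖ ≤ Cb * Kb ^ N * N ! * ‖z‖ ^ N) (N : ℕ) :
    ‖f * g - ∑ n ∈ Finset.range N, ((∑ i ∈ Finset.range (n + 1), a i * b (n - i) : ℝ) : ℂ) * z ^ n‖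
      ≤ (Ca * Cb + 3 * La * Cb) * max (max Ka Kb) Ea ^ N * N ! * ‖z‖ ^ N := by
  set Km : ℝ := max (max Ka Kb) Ea with hKm
  have hKaKm : Ka ≤ Km := by rw [hKm]; exact (le_max_left _ _).trans (le_max_left _ _)
  have hKbKm : Kb ≤ Km := by rw [hKm]; exact (le_max_right _ _).trans (le_max_left _ _)
  have hEaKm : Ea ≤ Km := by rw [hKm]; exact le_max_right _ _
  clear_value Km
  have hKm0 : 0 < Km := hKa.trans_le hKaKm
  have hz : 0 ≤ ‖z‖ := norm_nonneg z
  have hgsup : ‖g‖ ≤ Cb := by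
    have h := hg 0
    rw [Finset.sum_range_zero, sub_zero, pow_zero, pow_zero, Nat.factorial_zero, Nat.cast_one, mul_one, mul_one,
      mul_one] at h
    exact h
  have e : f * g - ∑ n ∈ Finset.range N, ((∑ i ∈ Finset.range (n + 1), a i * b (n - i) : ℝ) : ℂ) * z ^ n
      = (f - ∑ k ∈ Finset.range N, ((a k : ℝ) : ℂ) * z ^ k) * g
        + ∑ i ∈ Finset.range N, ((a i : ℝ) : ℂ) * z ^ i
            * (g - ∑ k ∈ Finset.range (N - i), ((b k : ℝ) : ℂ) * z ^ k) := by
    rw [← truncProd_eq a b z N]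
    simp only [mul_sub, Finset.sum_sub_distrib, sub_mul, Finset.sum_mul]
    ring
  rw [e]
  have h1 : ‖(f - ∑ k ∈ Finset.range N, ((a k : ℝ) : ℂ) * z ^ k) * g‖ ≤ Ca * Ka ^ N * N ! * ‖z‖ ^ N * Cb := by
    rw [norm_mul]; exact mul_le_mul (hf N) hgsup (norm_nonneg _) (by positivity)
  have h2 : ∀ i ∈ Finset.range N, ‖((a i : ℝ) : ℂ) * z ^ i * (g - ∑ k ∈ Finset.range (N - i), ((b k : ℝ) : ℂ) * z ^ k)‖
      ≤ La * Cb * Km ^ N * ((i ! : ℝ) * ((N - i)! : ℝ)) * ‖z‖ ^ N := by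
    intro i hi
    have hi' : i ≤ N := (Finset.mem_range.mp hi).le
    rw [norm_mul, norm_mul, norm_pow, Complex.norm_real, Real.norm_eq_abs]
    have hzN : ‖z‖ ^ i * ‖z‖ ^ (N - i) = ‖z‖ ^ N := by rw [← pow_add, Nat.add_sub_cancel' hi']
    have hEK : Ea ^ i * Kb ^ (N - i) ≤ Km ^ N := by
      have h := mul_le_mul (pow_le_pow_left₀ hEa.le hEaKm i) (pow_le_pow_left₀ hKb.le hKbKm (N - i))
        (by positivity) (by positivity)
      rwa [← pow_add, Nat.add_sub_cancel' hi'] at h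
    calc |a i| * ‖z‖ ^ i * ‖g - ∑ k ∈ Finset.range (N - i), ((b k : ℝ) : ℂ) * z ^ k‖
        ≤ La * (Ea ^ i * i !) * ‖z‖ ^ i * (Cb * Kb ^ (N - i) * (N - i)! * ‖z‖ ^ (N - i)) :=
          mul_le_mul (mul_le_mul_of_nonneg_right (ha i) (by positivity)) (hg (N - i)) (norm_nonneg _)
            (by positivity)
      _ = La * Cb * (Ea ^ i * Kb ^ (N - i)) * ((i ! : ℝ) * ((N - i)! : ℝ)) * (‖z‖ ^ i * ‖z‖ ^ (N - i)) := by ring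
      _ ≤ La * Cb * Km ^ N * ((i ! : ℝ) * ((N - i)! : ℝ)) * ‖z‖ ^ N := by rw [hzN]; gcongr
  have hs : ∑ i ∈ Finset.range N, ((i ! : ℝ) * ((N - i)! : ℝ)) ≤ 3 * N ! := by
    refine le_trans ?_ (sum_factorial_mul_factorial_le N)
    rw [Finset.sum_range_succ]
    have : 0 ≤ ((N ! : ℕ) : ℝ) * (((N - N)! : ℕ) : ℝ) := by positivity
    linarith
  have h3 : ‖∑ i ∈ Finset.range N, ((a i : ℝ) : ℂ) * z ^ i * (g - ∑ k ∈ Finset.range (N - i), ((b k : ℝ) : ℂ) * z ^ k)‖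
      ≤ La * Cb * Km ^ N * (3 * N !) * ‖z‖ ^ N := by
    refine (norm_sum_le _ _).trans ((Finset.sum_le_sum h2).trans ?_)
    rw [← Finset.sum_mul, ← Finset.mul_sum]
    gcongr
  calc ‖(f - ∑ k ∈ Finset.range N, ((a k : ℝ) : ℂ) * z ^ k) * g
        + ∑ i ∈ Finset.range N, ((a i : ℝ) : ℂ) * z ^ i * (g - ∑ k ∈ Finset.range (N - i), ((b k : ℝ) : ℂ) * z ^ k)‖
      ≤ Ca * Ka ^ N * N ! * ‖z‖ ^ N * Cb + La * Cb * Km ^ N * (3 * N !) * ‖z‖ ^ N :=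
        (norm_add_le _ _).trans (add_le_add h1 h3)
    _ ≤ Ca * Km ^ N * N ! * ‖z‖ ^ N * Cb + La * Cb * Km ^ N * (3 * N !) * ‖z‖ ^ N := by gcongr
    _ = (Ca * Cb + 3 * La * Cb) * Km ^ N * N ! * ‖z‖ ^ N := by ring

/-! ## §3 Primitives along the rays of a sector -/

/-- **PRIMITIVE OF A SECTORIAL GEVREY-1 EXPANSION.**  On the sector S(r, σ) = {‖z‖ < r, Re z > −σ‖z‖} let `G′ = g` (as `HasDerivAt`),
`G(t·z) → 0` as t → 0⁺ along every ray, and `‖g z − Σ_{k<N} d_k z^k‖ ≤ C·K^N·N!·‖z‖^N` for every N.  Then for every N and z ∈ S,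
`‖G z − Σ_{k<N} (d_k∕(k+1)) z^{k+1}‖ ≤ C·K^N·N!·‖z‖^{N+1}`: the sector contains the segment ]0, z], on which
ψ(w) = G w − Σ (d_k∕(k+1)) w^{k+1} has derivative g − Σ d_k w^k of norm ≤ C·K^N·N!·‖z‖^N; mean-value inequality on [ε, 1] and
ε → 0⁺. [folklore] -/
theorem gevrey_primitive {r σ C K : ℝ} {d : ℕ → ℝ} {g G : ℂ → ℂ} (hC : 0 ≤ C) (hK : 0 < K)
    (hG : ∀ z ∈ {z : ℂ | ‖z‖ < r ∧ -σ * ‖z‖ < z.re}, HasDerivAt G (g z) z)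
    (hG0 : ∀ z ∈ {z : ℂ | ‖z‖ < r ∧ -σ * ‖z‖ < z.re}, Tendsto (fun t : ℝ => G ((t : ℂ) * z)) (𝓝[>] 0) (𝓝 0))
    (hg : ∀ N : ℕ, ∀ z ∈ {z : ℂ | ‖z‖ < r ∧ -σ * ‖z‖ < z.re},
      ‖g z - ∑ k ∈ Finset.range N, ((d k : ℝ) : ℂ) * z ^ k‖ ≤ C * K ^ N * N ! * ‖z‖ ^ N) :
    ∀ N : ℕ, ∀ z ∈ {z : ℂ | ‖z‖ < r ∧ -σ * ‖z‖ < z.re},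
      ‖G z - ∑ k ∈ Finset.range N, ((d k / (k + 1) : ℝ) : ℂ) * z ^ (k + 1)‖ ≤ C * K ^ N * N ! * ‖z‖ ^ (N + 1) := by
  intro N z hz
  have hz0 : z ≠ 0 := by rintro rfl; exact absurd hz.2 (by simp)
  have hnz : 0 < ‖z‖ := norm_pos_iff.mpr hz0
  have hnorm : ∀ t : ℝ, 0 < t → ‖(t : ℂ) * z‖ = t * ‖z‖ := fun t ht => by
    rw [norm_mul, Complex.norm_real, Real.norm_eq_abs, abs_of_pos ht]
  have hray : ∀ t ∈ Ioc (0 : ℝ) 1, (t : ℂ) * z ∈ {z : ℂ | ‖z‖ < r ∧ -σ * ‖z‖ < z.re} := by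
    intro t ht
    refine ⟨?_, ?_⟩
    · rw [hnorm t ht.1]; exact (mul_le_of_le_one_left hnz.le ht.2).trans_lt hz.1
    · rw [hnorm t ht.1, Complex.re_ofReal_mul]
      have h := mul_lt_mul_of_pos_left hz.2 ht.1
      linarith
  -- ψ and its derivative ψ′ on the sector
  obtain ⟨ψ, hψ⟩ : ∃ ψ : ℂ → ℂ, ∀ w, ψ w = G w - ∑ k ∈ Finset.range N, ((d k / (k + 1) : ℝ) : ℂ) * w ^ (k + 1) :=
    ⟨fun w => G w - ∑ k ∈ Finset.range N, ((d k / (k + 1) : ℝ) : ℂ) * w ^ (k + 1), fun w => rfl⟩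
  obtain ⟨ψ', hψ'⟩ : ∃ ψ' : ℂ → ℂ, ∀ w, ψ' w = g w - ∑ k ∈ Finset.range N, ((d k : ℝ) : ℂ) * w ^ k :=
    ⟨fun w => g w - ∑ k ∈ Finset.range N, ((d k : ℝ) : ℂ) * w ^ k, fun w => rfl⟩
  have hψd : ∀ w ∈ {z : ℂ | ‖z‖ < r ∧ -σ * ‖z‖ < z.re}, HasDerivAt ψ (ψ' w) w := by
    intro w hw
    have hP : HasDerivAt (fun w : ℂ => ∑ k ∈ Finset.range N, ((d k / (k + 1) : ℝ) : ℂ) * w ^ (k + 1))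
        (∑ k ∈ Finset.range N, ((d k : ℝ) : ℂ) * w ^ k) w := by
      have h := HasDerivAt.fun_sum (u := Finset.range N)
        (fun k _ => (hasDerivAt_pow (k + 1) w).const_mul (((d k / (k + 1) : ℝ)) : ℂ))
      refine h.congr_deriv (Finset.sum_congr rfl fun k _ => ?_)
      have hk1 : ((k : ℂ) + 1) ≠ 0 := Nat.cast_add_one_ne_zero k
      rw [Nat.add_sub_cancel]; push_cast
      field_simp
    have hψf : ψ = fun w => G w - ∑ k ∈ Finset.range N, ((d k / (k + 1) : ℝ) : ℂ) * w ^ (k + 1) := funext hψ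
    rw [hψf, hψ']
    exact (hG w hw).sub hP
  -- the bound on ψ′ along the segment
  set B : ℝ := C * K ^ N * N ! * ‖z‖ ^ (N + 1) with hB
  have hB0 : 0 ≤ B := by positivity
  have hu : ∀ t : ℝ, HasDerivAt (fun s : ℝ => (s : ℂ) * z) z t := by
    intro t
    have h := ((hasDerivAt_id t).ofReal_comp).mul_const z
    simpa using h
  have hφd : ∀ t ∈ Ioc (0 : ℝ) 1, HasDerivAt (fun s : ℝ => ψ ((s : ℂ) * z)) (ψ' ((t : ℂ) * z) * z) t :=
    fun t ht => (hψd _ (hray t ht)).comp t (hu t)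
  have hbound : ∀ t ∈ Ioc (0 : ℝ) 1, ‖ψ' ((t : ℂ) * z) * z‖ ≤ B := by
    intro t ht
    have h := hg N _ (hray t ht)
    rw [norm_mul, hψ']
    calc ‖g ((t : ℂ) * z) - ∑ k ∈ Finset.range N, ((d k : ℝ) : ℂ) * ((t : ℂ) * z) ^ k‖ * ‖z‖
        ≤ C * K ^ N * N ! * ‖(t : ℂ) * z‖ ^ N * ‖z‖ := mul_le_mul_of_nonneg_right h hnz.le
      _ ≤ C * K ^ N * N ! * ‖z‖ ^ N * ‖z‖ := by
          rw [hnorm t ht.1]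
          gcongr
          · exact mul_nonneg ht.1.le hnz.le
          · exact mul_le_of_le_one_left hnz.le ht.2
      _ = B := by rw [hB]; ring
  have hmvt : ∀ ε ∈ Ioo (0 : ℝ) 1, ‖ψ (((1 : ℝ) : ℂ) * z) - ψ ((ε : ℂ) * z)‖ ≤ B := by
    intro ε hε
    have h := norm_image_sub_le_of_norm_deriv_le_segment' (f := fun s : ℝ => ψ ((s : ℂ) * z)) (a := ε) (b := 1)
      (fun t ht => (hφd t ⟨hε.1.trans_le ht.1, ht.2⟩).hasDerivWithinAt)
      (fun t ht => hbound t ⟨hε.1.trans_le ht.1, ht.2.le⟩) 1 (right_mem_Icc.mpr hε.2.le)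
    refine h.trans ?_
    calc B * (1 - ε) ≤ B * 1 := by gcongr; linarith [hε.1]
      _ = B := mul_one B
  -- ε → 0⁺
  have hlim : Tendsto (fun ε : ℝ => ψ ((ε : ℂ) * z)) (𝓝[>] 0) (𝓝 0) := by
    have h2 : Tendsto (fun ε : ℝ => ∑ k ∈ Finset.range N, ((d k / (k + 1) : ℝ) : ℂ) * ((ε : ℂ) * z) ^ (k + 1))
        (𝓝[>] 0) (𝓝 0) := by
      have hc : Continuous (fun ε : ℝ => ∑ k ∈ Finset.range N, ((d k / (k + 1) : ℝ) : ℂ) * ((ε : ℂ) * z) ^ (k + 1)) := by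
        fun_prop
      have h0 := hc.tendsto 0
      have e0 : (∑ k ∈ Finset.range N, ((d k / (k + 1) : ℝ) : ℂ) * ((((0 : ℝ)) : ℂ) * z) ^ (k + 1)) = 0 := by simp
      rw [e0] at h0
      exact tendsto_nhdsWithin_of_tendsto_nhds h0
    have h := (hG0 z hz).sub h2
    rw [sub_zero] at h
    exact h.congr fun ε => (hψ _).symm
  have hfin : ‖ψ (((1 : ℝ) : ℂ) * z)‖ ≤ B := by
    have hT : Tendsto (fun ε : ℝ => B + ‖ψ ((ε : ℂ) * z)‖) (𝓝[>] 0) (𝓝 (B + ‖(0 : ℂ)‖)) :=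
      tendsto_const_nhds.add hlim.norm
    rw [norm_zero, add_zero] at hT
    refine ge_of_tendsto hT ?_
    have hev : ∀ᶠ ε in 𝓝[>] (0 : ℝ), ε ∈ Ioi (0 : ℝ) ∧ ε < 1 :=
      eventually_mem_nhdsWithin.and (eventually_nhdsWithin_of_eventually_nhds (eventually_lt_nhds zero_lt_one))
    filter_upwards [hev] with ε hε
    have h1 := hmvt ε ⟨hε.1, hε.2⟩
    have h2 := norm_sub_norm_le (ψ (((1 : ℝ) : ℂ) * z)) (ψ ((ε : ℂ) * z))
    linarith
  have e : ψ (((1 : ℝ) : ℂ) * z) = G z - ∑ k ∈ Finset.range N, ((d k / (k + 1) : ℝ) : ℂ) * z ^ (k + 1) := by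
    rw [Complex.ofReal_one, one_mul, hψ]
  rw [← e]; exact hfin

end Summit.QuantumFields.BalabanUV.Beta.EriceFlowEnclosureGevreySectorAlgebra
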